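import Summits.Ventures.PackingBounds.ThreePointCert.S3T11Proof
import Summits.Ventures.PackingBounds.Configurations.PetersenCode
import Summits.Ventures.PackingBounds.SphericalCodes.TammesReading

/-!
# The 11-point problem on `S³`: `θ₁₁(S³) < arccos(83/400)` and `A(4, arccos s) = 10` on `[1/6, 83/400]`

Framing: lottery ticket; floor = certified bounds/negative ranges. Venture `PackingBounds`
(cell `pub-packcert`), spherical-codes family, table B2d cell `(S³, N = 11)` (request R9-2).

Upper side: the kernel-checked Bachoc–Vallentin three-point certificate
`ThreePointCert.S3T11.tammesS3_11_card_le_10_sdp` (`n = 4`, `s = 83/400`, degree 10, Bachoc–Vallentin's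
multiplier set; exact bound value `10.975084 < 11`): every set of unit vectors of `ℝ⁴` with pairwise
inner products `≤ 83/400` has at most `10` elements. Lower side: the Petersen code
(`Config.PetersenCode.exists_code_10_of_le`: ten unit vectors of `ℝ⁴` with pairwise inner products
`≤ 1/6`). Together: the largest size of a spherical code in `S³` with minimal angle `≥ arccos s` is
exactly `10` for every `s ∈ [1/6, 83/400]` (this widens `code_dim4_eq_10_of_mem_Icc`, which had
`[1/6, 1/5]`); in Tammes form, among any `11` unit vectors of `ℝ⁴` two distinct ones make an angle
`< arccos(83/400) = 78.024…°`. Print record for the 11-point problem on `S³`: Pfender 2007, Table 2,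
`78.73°` (best configuration known `76.67°`). A certified bound, not a configuration.

## References
* C. Bachoc, F. Vallentin, J. Amer. Math. Soc. 21 (2008), Theorem 4.2. [`BachocVallentin2007`]
* F. Pfender, J. Combin. Theory Ser. A 114 (2007) 1133–1147, Table 2.
-/

noncomputable section

open Finset
open scoped RealInnerProductSpace

namespace Summit.Ventures.PackingBounds.SphericalCodes

/-- **`A(4, arccos s) = 10` on `[1/6, 83/400]`** (two-sided, kernel-checked): for `1/6 ≤ s ≤ 83/400`
there is a 10-point code of unit vectors of `ℝ⁴` with pairwise inner products `≤ s` (Petersen code),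
and every such code has at most `10` points (three-point SDP certificate at `s = 83/400`). -/
theorem code_dim4_eq_10_of_mem_Icc_83_400 {s : ℝ} (hs : (1 / 6 : ℝ) ≤ s) (hs' : s ≤ 83 / 400) :
    (∃ C : Finset (EuclideanSpace ℝ (Fin 4)), C.card = 10 ∧ (∀ x ∈ C, ‖x‖ = 1) ∧
      (∀ x ∈ C, ∀ y ∈ C, x ≠ y → inner ℝ x y ≤ s)) ∧
    ∀ C : Finset (EuclideanSpace ℝ (Fin 4)), (∀ x ∈ C, ‖x‖ = 1) →
      (∀ x ∈ C, ∀ y ∈ C, x ≠ y → inner ℝ x y ≤ s) → C.card ≤ 10 :=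
  ⟨Config.PetersenCode.exists_code_10_of_le hs, fun C h1 h2 =>
    ThreePointCert.S3T11.tammesS3_11_card_le_10_sdp C h1
      (fun x hx y hy hxy => (h2 x hx y hy hxy).trans hs')⟩

/-- **Tammes form, inner products** (the 11-point problem on `S³`): among any `11` or more unit vectors
of `ℝ⁴`, two distinct ones have inner product `> 83/400`. -/
theorem exists_inner_gt_83_400_of_card_gt_10 (C : Finset (EuclideanSpace ℝ (Fin 4)))
    (h1 : ∀ x ∈ C, ‖x‖ = 1) (hC : 10 < C.card) :
    ∃ x ∈ C, ∃ y ∈ C, x ≠ y ∧ (83 / 400 : ℝ) < inner ℝ x y :=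
  exists_inner_gt_of_codeBound ThreePointCert.S3T11.tammesS3_11_card_le_10_sdp C h1 hC

/-- **Tammes form, angles**: among any `11` or more unit vectors of `ℝ⁴`, two distinct ones make an
(unoriented) angle `< arccos(83/400)` (`= 78.024…°`; print record `78.73°`, Pfender 2007 Table 2). -/
theorem exists_angle_lt_arccos_83_400_of_card_gt_10 (C : Finset (EuclideanSpace ℝ (Fin 4)))
    (h1 : ∀ x ∈ C, ‖x‖ = 1) (hC : 10 < C.card) :
    ∃ x ∈ C, ∃ y ∈ C, x ≠ y ∧ InnerProductGeometry.angle x y < Real.arccos (83 / 400) :=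
  exists_angle_lt_arccos_of_codeBound ThreePointCert.S3T11.tammesS3_11_card_le_10_sdp
    (by norm_num) C h1 hC

/-- **`θ₁₁(S³) < arccos(83/400)`**: any common lower bound `θ` for the pairwise angles of `11` or more
unit vectors of `ℝ⁴` satisfies `θ < arccos(83/400)`. -/
theorem minAngle_lt_arccos_83_400_of_card_gt_10 (C : Finset (EuclideanSpace ℝ (Fin 4)))
    (h1 : ∀ x ∈ C, ‖x‖ = 1) (hC : 10 < C.card) (θ : ℝ)
    (hθ : ∀ x ∈ C, ∀ y ∈ C, x ≠ y → θ ≤ InnerProductGeometry.angle x y) :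
    θ < Real.arccos (83 / 400) :=
  minAngle_lt_arccos_of_codeBound ThreePointCert.S3T11.tammesS3_11_card_le_10_sdp
    (by norm_num) C h1 hC θ hθ

end Summit.Ventures.PackingBounds.SphericalCodes

end
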